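import Mathlib
import Summits.KontsevichZagierPeriods.Zeta5Search.CatalanQSum
import HarnessLib

/-!
# Catalan box family — read-out of the kernel certificates of `CatalanQSum` in the language of the laws

HONEST FRAMING: systematic search; no irrationality claim unless certified.  Cell `pub-zeta5`, seat `fam-catalan`
(`run/shared/lean/pub/pub-zeta5/families/catalan/FAMILY.md` §5.2, `QSUM.md` §5–§6).  Nothing here concerns the arithmetic nature of `G`.

`CatalanQSum.lean` certifies, by `decide +kernel`, Boolean tests `lawOK` at every parameter set of the box with coordinates `≤ 6` and along
eight rays, and records the all-parameter statements `TwoAdicLaw` (exact 2-adic order of the `G`-coefficient `catalanQ`, via `padicValRat` and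
binary digit sums `Nat.digits`) and `DyadicLaw` (the reduced denominator of `catalanQ` is a power of `2`) as `@[conjecture]` nodes.  This file
proves the two small bridges that turn the Boolean certificates into instances of those laws IN THEIR OWN TERMS:
* `bitsum_eq_digits_sum : KernelKit.bitsum n = (Nat.digits 2 n).sum` (the kit's structural-recursion digit sum is Mathlib's);
* `padicValRat_two_eq_zero_of_den` : for `x ≠ 0`, "`x` has odd reduced denominator and `x/2` has even reduced denominator" means
  `padicValRat 2 x = 0`; whence `lawOK_readout` : `lawOK H J K L M = true` implies `catalanQ H J K L M ≠ 0`, the exact order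
  `padicValRat 2 (catalanQ H J K L M) = 3 − 2(S+C) + s₂(S) + s₂(C)` (`S = J+K−M`, `C = K+L−H`) and `∃ e, (catalanQ H J K L M).den = 2^e`;
* consequently `twoAdicLaw_box6` / `dyadicLaw_box6` : the statements of `TwoAdicLaw` / `DyadicLaw` HOLD at every parameter set of the box with
  `H, J, K, L, M ≤ 6` (6 419 sets), and `twoAdicLaw_diagonal` : on the diagonal for `n ≤ 50`, `v₂(Q(n,n,n,n,n)) = 3 − 4n + 2 s₂(n)`
  (Zudilin's `v₂(u_n) = 2 s₂(n) − 4n` read through `diagonal_eq_zudilin_u`).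
The general laws remain conjecture nodes (the `Q`-side of `TwoAdicLaw` and `DyadicLaw` are proved on paper in the cell's notes, not formalised).
-/

namespace Summit.KontsevichZagierPeriods.Zeta5Search.CatalanQSum

open Summit.KontsevichZagierPeriods.Zeta5Search.KernelKit

/-! ### The kit's digit sum is Mathlib's -/

/-- `bitsumAux fuel n = s₂(n)` as soon as the fuel covers `n`. -/
theorem bitsumAux_eq_digits_sum : ∀ fuel n : ℕ, n ≤ fuel → bitsumAux fuel n = (Nat.digits 2 n).sum := by
  intro fuel
  induction fuel with
  | zero =>
    intro n hn
    obtain rfl : n = 0 := Nat.le_zero.mp hn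
    simp [bitsumAux]
  | succ fuel ih =>
    intro n hn
    by_cases h0 : n = 0
    · subst h0; simp [bitsumAux]
    · rw [bitsumAux, if_neg h0, Nat.digits_def' (by norm_num) (Nat.pos_of_ne_zero h0), List.sum_cons,
        ih (n / 2) (by omega)]

/-- **`KernelKit.bitsum` is the binary digit sum**: `bitsum n = (Nat.digits 2 n).sum`. -/
theorem bitsum_eq_digits_sum (n : ℕ) : bitsum n = (Nat.digits 2 n).sum :=
  bitsumAux_eq_digits_sum n n le_rfl

/-! ### Odd / even reduced denominators and the 2-adic valuation -/

/-- A rational number with odd reduced denominator has non-negative 2-adic valuation. -/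
theorem padicValRat_two_nonneg_of_den_odd {x : ℚ} (h : x.den % 2 = 1) : 0 ≤ padicValRat 2 x := by
  have hnd : ¬ 2 ∣ x.den := Nat.two_dvd_ne_zero.mpr h
  have h0 : padicValNat 2 x.den = 0 := padicValNat.eq_zero_of_not_dvd hnd
  unfold padicValRat
  rw [h0]
  simp

/-- A rational number with even reduced denominator (hence nonzero) has negative 2-adic valuation. -/
theorem padicValRat_two_neg_of_den_even {x : ℚ} (h : x.den % 2 ≠ 1) : padicValRat 2 x < 0 := by
  have hd : 2 ∣ x.den := Nat.dvd_of_mod_eq_zero (by omega)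
  have hnum : ¬ (2 : ℤ) ∣ x.num := by
    intro h2
    have hcop := x.reduced
    have : (2 : ℕ) ∣ Nat.gcd x.num.natAbs x.den := Nat.dvd_gcd (by
      have := Int.natAbs_dvd_natAbs.mpr h2; simpa using this) hd
    rw [hcop] at this
    exact absurd this (by norm_num)
  have h1 : padicValInt 2 x.num = 0 := padicValInt.eq_zero_of_not_dvd hnum
  have h2 : 1 ≤ padicValNat 2 x.den := one_le_padicValNat_of_dvd x.den_nz hd
  unfold padicValRat
  rw [h1]
  simp only [CharP.cast_eq_zero, zero_sub, Left.neg_neg_iff]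
  exact_mod_cast h2

/-- For `x ≠ 0`: odd reduced denominator of `x` and even reduced denominator of `x / 2` pin the valuation: `padicValRat 2 x = 0`. -/
theorem padicValRat_two_eq_zero_of_den {x : ℚ} (hx : x ≠ 0) (h1 : x.den % 2 = 1) (h2 : (x / 2).den % 2 ≠ 1) :
    padicValRat 2 x = 0 := by
  have hlow := padicValRat_two_nonneg_of_den_odd h1
  have hup := padicValRat_two_neg_of_den_even h2
  have hdiv : padicValRat 2 (x / 2) = padicValRat 2 x - 1 := by
    rw [padicValRat.div hx two_ne_zero]
    have : padicValRat 2 (2 : ℚ) = 1 := padicValRat.self one_lt_two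
    rw [this]
  rw [hdiv] at hup
  omega

/-- The valuation bookkeeping: `v₂(2^a · q / 2^b) = a + v₂(q) − b` for `q ≠ 0`. -/
theorem padicValRat_two_scaled {q : ℚ} (hq : q ≠ 0) (a b : ℕ) :
    padicValRat 2 (2 ^ a * q / 2 ^ b) = a + padicValRat 2 q - b := by
  have h2 : (2 : ℚ) ≠ 0 := two_ne_zero
  have hself : padicValRat 2 (2 : ℚ) = 1 := padicValRat.self one_lt_two
  rw [padicValRat.div (mul_ne_zero (pow_ne_zero _ h2) hq) (pow_ne_zero _ h2),
    padicValRat.mul (pow_ne_zero _ h2) hq, padicValRat.pow (2 : ℚ), padicValRat.pow (2 : ℚ), hself]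
  ring

/-- A rational `q` with `2^a q / 8 ∈ ℤ` has a power of `2` as reduced denominator. -/
theorem den_pow_two_of_int {q : ℚ} {a : ℕ} (h : ∃ z : ℤ, (z : ℚ) = 2 ^ a * q / 8) : ∃ e : ℕ, q.den = 2 ^ e := by
  obtain ⟨z, hz⟩ := h
  have hq : q = Rat.divInt (8 * z) (2 ^ a) := by
    rw [Rat.divInt_eq_div]
    push_cast
    rw [eq_div_iff (pow_ne_zero _ two_ne_zero), hz]
    field_simp
  have hdvd : (q.den : ℤ) ∣ (2 : ℤ) ^ a := by
    rw [hq]; exact_mod_cast Rat.den_dvd (8 * z) (2 ^ a)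
  have hdvd' : q.den ∣ 2 ^ a := by exact_mod_cast hdvd
  obtain ⟨e, -, he⟩ := (Nat.dvd_prime_pow Nat.prime_two).1 hdvd'
  exact ⟨e, he⟩

/-! ### Read-out of `lawOK` -/

/-- **Read-out**: a passed test `lawOK H J K L M` gives `Q ≠ 0`, the EXACT 2-adic order
`v₂(Q) = 3 − 2(S+C) + s₂(S) + s₂(C)` (`S = J+K−M`, `C = K+L−H`, `s₂` = `Nat.digits` binary digit sum) and a power-of-two denominator. -/
theorem lawOK_readout {H J K L M : ℕ} (h : lawOK H J K L M = true) :
    catalanQ H J K L M ≠ 0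
    ∧ padicValRat 2 (catalanQ H J K L M)
        = 3 - 2 * (((J + K - M : ℕ) : ℤ) + ((K + L - H : ℕ) : ℤ))
          + ((Nat.digits 2 (J + K - M)).sum : ℤ) + ((Nat.digits 2 (K + L - H)).sum : ℤ)
    ∧ ∃ e : ℕ, (catalanQ H J K L M).den = 2 ^ e := by
  obtain ⟨hint, hodd, heven⟩ := lawOK_spec h
  set q := catalanQ H J K L M with hqdef
  set S := J + K - M
  set C := K + L - H
  have hq : q ≠ 0 := by
    intro h0
    apply heven
    rw [h0]; simp
  set x : ℚ := 2 ^ (2 * (S + C)) * q / 2 ^ (bitsum S + bitsum C + 3) with hxdef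
  have hx : x ≠ 0 := div_ne_zero (mul_ne_zero (pow_ne_zero _ two_ne_zero) hq) (pow_ne_zero _ two_ne_zero)
  have hx2 : x / 2 = 2 ^ (2 * (S + C)) * q / 2 ^ (bitsum S + bitsum C + 4) := by
    rw [hxdef, pow_succ]; ring
  have hv0 : padicValRat 2 x = 0 := padicValRat_two_eq_zero_of_den hx hodd (by rw [hx2]; exact heven)
  rw [hxdef, padicValRat_two_scaled hq] at hv0
  refine ⟨hq, ?_, den_pow_two_of_int hint⟩
  rw [← bitsum_eq_digits_sum, ← bitsum_eq_digits_sum]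
  push_cast at hv0 ⊢
  linarith

/-- **`TwoAdicLaw` holds on the whole box `H, J, K, L, M ≤ 6`** (its statement, verbatim, restricted to that range). -/
theorem twoAdicLaw_box6 {H J K L M : ℕ} (hH : H ≤ 6) (hJ : J ≤ 6) (hK : K ≤ 6) (hL : L ≤ 6) (hM : M ≤ 6)
    (h1 : H ≤ K + L) (h2 : J ≤ L + M) (h3 : K ≤ M + H) (h4 : L ≤ H + J) (h5 : M + 1 ≤ J + K) :
    padicValRat 2 (catalanQ H J K L M)
      = 3 - 2 * (((J + K - M : ℕ) : ℤ) + ((K + L - H : ℕ) : ℤ))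
        + ((Nat.digits 2 (J + K - M)).sum : ℤ) + ((Nat.digits 2 (K + L - H)).sum : ℤ) :=
  (lawOK_readout (lawOK_box6 hH hJ hK hL hM
    (by simp only [inBoxB, Bool.and_eq_true, decide_eq_true_eq]; omega))).2.1

/-- **`DyadicLaw` holds on the whole box `H, J, K, L, M ≤ 6`**. -/
theorem dyadicLaw_box6 {H J K L M : ℕ} (hH : H ≤ 6) (hJ : J ≤ 6) (hK : K ≤ 6) (hL : L ≤ 6) (hM : M ≤ 6)
    (h1 : H ≤ K + L) (h2 : J ≤ L + M) (h3 : K ≤ M + H) (h4 : L ≤ H + J) (h5 : M + 1 ≤ J + K) :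
    ∃ e : ℕ, (catalanQ H J K L M).den = 2 ^ e :=
  (lawOK_readout (lawOK_box6 hH hJ hK hL hM
    (by simp only [inBoxB, Bool.and_eq_true, decide_eq_true_eq]; omega))).2.2

/-- **The diagonal for `n ≤ 50`**: `v₂(Q(n,n,n,n,n)) = 3 − 4n + 2 s₂(n)` and `Q(n,n,n,n,n) ≠ 0` — Zudilin's `v₂(u_n) = 2 s₂(n) − 4n`
for his `u_n = (−1)ⁿ Q/8` (`diagonal_eq_zudilin_u`), here in `padicValRat` form. -/
theorem twoAdicLaw_diagonal {n : ℕ} (hn : n ≤ 50) :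
    catalanQ n n n n n ≠ 0 ∧ padicValRat 2 (catalanQ n n n n n) = 3 - 4 * (n : ℤ) + 2 * ((Nat.digits 2 n).sum : ℤ) := by
  obtain ⟨hq, hv, -⟩ := lawOK_readout (lawOK_rays.1 n hn)
  refine ⟨hq, ?_⟩
  rw [hv]
  have e1 : n + n - n = n := by omega
  rw [e1]
  push_cast
  ring

end Summit.KontsevichZagierPeriods.Zeta5Search.CatalanQSum
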